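import Mathlib.Analysis.SpecialFunctions.Pow.Real
import Mathlib.Tactic.Ring
import Mathlib.Tactic.Linarith
import Mathlib.Tactic.Positivity
import Mathlib.Tactic.FieldSimp
import Literature.Algebra.Polynomial.CoeffList
import HarnessLib

/-!
# Coefficient lists: kernel-checked sign certificates on half-lines and intervals

Topic `Literature/Algebra/Polynomial`; a trunk-independent tool extending
`Literature/Algebra/Polynomial/CoeffList.lean`. To certify that an explicit integer polynomial
`p` is positive on a half-line `{u < a}` / `{a < u}` or on an interval `[a, b)`, one substitutes
`u = a ∓ t` resp. `u = (a + b t)/(1 + t)` (`t > 0` resp. `t ≥ 0`) and checks that the resulting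
polynomial in `t` has nonnegative coefficients, not all zero (Pólya's criterion with exponent `0`;
when needed one first multiplies by a power of `1 + t`, which is again a list operation). Here:

* `CoeffList.comp p r` — composition `p ∘ r` of coefficient lists, `eval_comp`;
* `CoeffList.homog p A B = Σₖ pₖ Aᵏ Bⁿ⁻ᵏ` (`n = length p − 1`) — the numerator of `p (A/B)`,
  `eval_homog` (`Bⁿ · p(A/B) = homog p A B` wherever `B ≠ 0`);
* `CoeffList.eval_nonneg_of_coeffs`, `eval_pos_of_coeffs` (`t > 0`, some coefficient
  non-zero), `eval_pos_of_coeffs_cons` (`t ≥ 0`, constant coefficient `> 0`) over ordered rings;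
* `CoeffList.lengthPred` (the exponent `n`).

The checks `allNonneg … = true`, `isZero … = false` are `decide`d by the kernel; the transports are
the lemmas above. Everything is proved. [folklore]
-/

namespace Literature.Algebra.Polynomial.CoeffList

/-! ### Composition and homogenisation -/

section CommRing

variable {R : Type*} [CommRing R]

/-- Composition of coefficient lists: `comp p r` represents `p (r (t))` (Horner). [folklore] -/
def comp : List ℤ → List ℤ → List ℤ
  | [], _ => []
  | a :: p, r => add [a] (mul r (comp p r))

/-- `eval t (comp p r) = eval (eval t r) p`. [folklore] -/
@[simp] theorem eval_comp (t : R) : ∀ p r : List ℤ, eval t (comp p r) = eval (eval t r) p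
  | [], r => by simp [comp]
  | a :: p, r => by
      rw [comp, eval_add, eval_mul, eval_comp t p r, eval_cons, eval_cons, eval_nil]
      ring

/-- The exponent of a coefficient list: `length − 1` (the degree when the last entry is non-zero).
[folklore] -/
def lengthPred (p : List ℤ) : ℕ := p.length - 1

/-- Powers of a coefficient list (local copy, to keep this file independent of other extensions).
[folklore] -/
def npow (p : List ℤ) : ℕ → List ℤ
  | 0 => [1]
  | n + 1 => mul (npow p n) p

/-- `eval` of `npow`. [folklore] -/
@[simp] theorem eval_npow (t : R) (p : List ℤ) : ∀ n : ℕ, eval t (npow p n) = eval t p ^ n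
  | 0 => by simp [npow]
  | n + 1 => by rw [npow, eval_mul, eval_npow t p n, pow_succ]

/-- Homogenisation against a denominator: `homog [p₀, …, pₙ] A B = Σₖ pₖ Aᵏ Bⁿ⁻ᵏ`, the numerator
of `p (A/B)`. [folklore] -/
def homog : List ℤ → List ℤ → List ℤ → List ℤ
  | [], _, _ => []
  | [c], _, _ => [c]
  | c :: d :: p, A, B => add (smul c (npow B (p.length + 1))) (mul A (homog (d :: p) A B))

/-- `lengthPred` of a list with at least two entries. [folklore] -/
theorem lengthPred_cons_cons (c d : ℤ) (p : List ℤ) :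
    lengthPred (c :: d :: p) = lengthPred (d :: p) + 1 := by
  simp [lengthPred]

end CommRing

section Field

variable {K : Type*} [Field K]

/-- **Homogenisation identity**: `eval t (homog p A B) = (eval t B)ⁿ · eval (eval t A / eval t B) p`
with `n = lengthPred p`, wherever `eval t B ≠ 0`. [folklore] -/
theorem eval_homog (t : K) (A B : List ℤ) (hB : eval t B ≠ 0) :
    ∀ p : List ℤ, eval t (homog p A B) = eval t B ^ lengthPred p * eval (eval t A / eval t B) p
  | [] => by simp [homog]
  | [c] => by simp [homog, lengthPred]
  | c :: d :: p => by
      rw [homog, eval_add, eval_smul, eval_npow, eval_mul, eval_homog t A B hB (d :: p),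
        lengthPred_cons_cons]
      have hn : lengthPred (d :: p) = p.length := by simp [lengthPred]
      rw [hn, eval_cons (eval t A / eval t B) c (d :: p), pow_succ]
      field_simp

end Field

/-! ### Positivity from nonnegative coefficients -/

section Ordered

variable {R : Type*} [CommRing R] [LinearOrder R] [IsStrictOrderedRing R]

/-- Nonnegative coefficients give a nonnegative value at every `t ≥ 0`. [folklore] -/
theorem eval_nonneg_of_coeffs {t : R} (ht : 0 ≤ t) :
    ∀ p : List ℤ, allNonneg p = true → 0 ≤ eval t p
  | [], _ => le_rfl
  | a :: p, h => by
      simp only [allNonneg, Bool.and_eq_true, decide_eq_true_eq] at h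
      rw [eval_cons]
      have ha : (0 : R) ≤ (a : R) := by exact_mod_cast h.1
      exact add_nonneg ha (mul_nonneg ht (eval_nonneg_of_coeffs ht p h.2))

/-- Nonnegative coefficients, not all zero, give a positive value at every `t > 0`. [folklore] -/
theorem eval_pos_of_coeffs {t : R} (ht : 0 < t) :
    ∀ p : List ℤ, allNonneg p = true → isZero p = false → 0 < eval t p
  | [], _, h0 => by simp [isZero] at h0
  | a :: p, h, h0 => by
      simp only [allNonneg, Bool.and_eq_true, decide_eq_true_eq] at h
      rw [eval_cons]
      have ha : (0 : R) ≤ (a : R) := by exact_mod_cast h.1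
      by_cases hz : isZero p = true
      · -- then `a ≠ 0`, hence `a > 0`
        have ha0 : a ≠ 0 := by
          intro ha0
          simp [isZero, ha0, hz] at h0
        have ha' : (0 : R) < (a : R) := by exact_mod_cast lt_of_le_of_ne h.1 (Ne.symm ha0)
        have := eval_eq_zero_of_isZero t p hz
        rw [this, mul_zero, add_zero]
        exact ha'
      · have hp : 0 < eval t p := eval_pos_of_coeffs ht p h.2 (by simpa using hz)
        exact add_pos_of_nonneg_of_pos ha (mul_pos ht hp)

/-- A positive constant coefficient and nonnegative higher coefficients give a positive value at
every `t ≥ 0`. [folklore] -/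
theorem eval_pos_of_coeffs_cons {t : R} (ht : 0 ≤ t) (a : ℤ) (p : List ℤ) (ha : 0 < a)
    (h : allNonneg p = true) : 0 < eval t (a :: p) := by
  rw [eval_cons]
  have ha' : (0 : R) < (a : R) := by exact_mod_cast ha
  exact add_pos_of_pos_of_nonneg ha' (mul_nonneg ht (eval_nonneg_of_coeffs ht p h))

/-- **Half-line certificate (left).** If `comp p [a, -1]` (the list of `t ↦ p (a − t)`) has
nonnegative coefficients, not all zero, then `p u > 0` for every `u < a`. [folklore] -/
theorem eval_pos_of_lt {p : List ℤ} {a : ℤ}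
    (h : allNonneg (comp p [a, -1]) = true) (h0 : isZero (comp p [a, -1]) = false)
    {u : R} (hu : u < a) : 0 < eval u p := by
  have ht : (0 : R) < (a : R) - u := sub_pos.mpr hu
  have key := eval_pos_of_coeffs ht _ h h0
  rw [eval_comp] at key
  have : eval ((a : R) - u) [a, -1] = u := by
    simp [eval_cons]
  rwa [this] at key

/-- **Half-line certificate (left, closed).** If `comp p [a, -1] = c :: q` with `c > 0` and `q`
nonnegative then `p u > 0` for every `u ≤ a`. [folklore] -/
theorem eval_pos_of_le {p : List ℤ} {a c : ℤ} {q : List ℤ} (hcq : comp p [a, -1] = c :: q)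
    (hc : 0 < c) (h : allNonneg q = true) {u : R} (hu : u ≤ a) : 0 < eval u p := by
  have ht : (0 : R) ≤ (a : R) - u := sub_nonneg.mpr hu
  have key := eval_pos_of_coeffs_cons ht c q hc h
  rw [← hcq, eval_comp] at key
  have : eval ((a : R) - u) [a, -1] = u := by
    simp [eval_cons]
  rwa [this] at key

/-- **Half-line certificate (right).** If `comp p [a, 1]` has nonnegative coefficients, not all
zero, then `p u > 0` for every `u > a`. [folklore] -/
theorem eval_pos_of_gt {p : List ℤ} {a : ℤ}
    (h : allNonneg (comp p [a, 1]) = true) (h0 : isZero (comp p [a, 1]) = false)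
    {u : R} (hu : (a : R) < u) : 0 < eval u p := by
  have ht : (0 : R) < u - a := sub_pos.mpr hu
  have key := eval_pos_of_coeffs ht _ h h0
  rw [eval_comp] at key
  have : eval (u - (a : R)) [a, 1] = u := by
    simp [eval_cons]
  rwa [this] at key

end Ordered

section LinearOrderedField

variable {K : Type*} [Field K] [LinearOrder K] [IsStrictOrderedRing K]

/-- **Interval certificate.** Let `A = [a₀, a₁]`, `B = [b₀, b₁]` be integer affine lists with
`B(t) > 0` for `t ≥ 0`; if `homog p A B` has a positive constant coefficient and nonnegative higher
ones, then `p (A(t)/B(t)) > 0` for every `t ≥ 0` — i.e. `p > 0` on the image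
`{(a₀ + a₁ t)/(b₀ + b₁ t) : t ≥ 0}`, an interval with end points `a₀/b₀` and `a₁/b₁`.
[folklore] -/
theorem eval_div_pos_of_homog {p A B : List ℤ} {c : ℤ} {q : List ℤ}
    (hcq : homog p A B = c :: q) (hc : 0 < c) (h : allNonneg q = true)
    {t : K} (ht : 0 ≤ t) (hB : 0 < eval t B) :
    0 < eval (eval t A / eval t B) p := by
  have key := eval_pos_of_coeffs_cons ht c q hc h
  rw [← hcq, eval_homog t A B hB.ne'] at key
  by_contra hle
  rw [not_lt] at hle
  exact absurd key (not_lt.mpr (mul_nonpos_of_nonneg_of_nonpos (pow_pos hB _).le hle))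

end LinearOrderedField

end Literature.Algebra.Polynomial.CoeffList
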